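import Literature.Computability.Complexity.LWESearchToDecisionMachine
import Literature.Computability.Complexity.IntVectorBricks
import HarnessLib

/-!
# The machine of the search-to-decision reduction for LWE, Ib: values of the string maps on records

Continuing `LWESearchToDecisionMachine.lean`: the values of `S2D.queryFn`, of the accessors and of the
one-bit tests `S2D.resFn`, `S2D.evalFn` on records `⟨⟨x, r⟩, c⟩`, `⟨⟨⟨x, r⟩, a⟩, u⟩`, `⟨⟨⟨x, r⟩, a⟩, bits⟩`
with ARBITRARY fields (total equations; the inner product `S2D.dotFn` is unclipped through the
bound `|pieces| ≤ 2 (|z| + 1)`, valid on every input because all reads are projections of `z`;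
the list-access bounds are those of `IntVectorBricks.lean`, `Brick.length_elemOf_le`).
The specialisation to codes of LWE samples is `Cryptography/LWESearchToDecisionMachineSpec.lean`.

## References

* S. Arora, B. Barak, *Computational Complexity: A Modern Approach*, CUP 2009, §0.1, §1.3
  [AroraBarakCC2009].
-/

noncomputable section

namespace Literature.Computability.Complexity

open _root_.Computability Polynomial Brick PRelSigPi

namespace S2D

/-! ### Lengths of projections -/

/-- Pair components are within the string: `|fstF w| ≤ |w|` and `|sndF w| ≤ |w|`. [folklore] -/
theorem length_fstF_le_and (w : List Bool) : (fstF w).length ≤ w.length ∧ (sndF w).length ≤ w.length := by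
  have := length_boolUnpair_parts_le w
  simp only [fstF, sndF]
  omega

/-- `|sndPow 2 w| ≤ |w|`. [folklore] -/
theorem length_sndPow_two_le (w : List Bool) : (sndPow 2 w).length ≤ w.length := by
  simp only [sndPow, Function.comp_apply]
  exact (length_fstF_le_and _).2.trans ((length_fstF_le_and _).2.trans (length_fstF_le_and _).2)

/-! ### Values on records -/

section Values

variable (C k : ℕ) (x r a u : List Bool)

/-- **Value of the query map** on `⟨⟨x, r⟩, c⟩`. [folklore] -/
theorem queryFn_rec (c : List Bool) : queryFn C (boolPair (boolPair x r) c) =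
    boolPair (nthF 0 x) (boolPair (nthF 1 x)
      (boolPair ((nthF 2 x).drop (tunF C x).length) (sndP^[(tunF C x).length] (sndPow 2 x)))) := by
  simp [queryFn, nthRest]

/-- The sample code off `z = ⟨⟨⟨x, r⟩, a⟩, u⟩`. [folklore] -/
@[simp] theorem xOf_rec : xOf (boolPair (boolPair (boolPair x r) a) u) = x := by simp [xOf]

/-- The answer off `z`. [folklore] -/
@[simp] theorem aOf_rec : aOf (boolPair (boolPair (boolPair x r) a) u) = a := by simp [aOf]

/-- The item off `z`: element `|u|` of the item list. [folklore] -/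
@[simp] theorem itemOf_rec :
    itemOf (boolPair (boolPair (boolPair x r) a) u) = elemOf (sndPow 2 x) u.length := by
  simp [itemOf, xOf, elemFn_boolPair]

/-- The `a`-body off `z`. [folklore] -/
@[simp] theorem asOf_rec :
    asOf (boolPair (boolPair (boolPair x r) a) u) = sndF (fstF (elemOf (sndPow 2 x) u.length)) := by
  simp [asOf]

/-- The numeral `b` off `z`. [folklore] -/
@[simp] theorem bOf_rec : bOf (boolPair (boolPair (boolPair x r) a) u) = sndF (elemOf (sndPow 2 x) u.length) := by
  simp [bOf]

/-- The secret body off `z`. [folklore] -/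
@[simp] theorem svOf_rec : svOf (boolPair (boolPair (boolPair x r) a) u) = sndF (fstF a) := by
  simp [svOf]

/-- The header test off `z`. [folklore] -/
theorem hdrOk_rec : hdrOk (boolPair (boolPair (boolPair x r) a) u) =
    [decide ((fstF (fstF a)).length = bitsToNat (nthF 0 x))] := by
  simp [hdrOk, xOf, aOf, bitsToNat_encodeNat]

/-- The `i = |v|`-th piece on `⟨z, v⟩`. [folklore] -/
theorem pieceFn_rec (z v : List Bool) : pieceFn (boolPair z v) =
    encodeNat (bitsToNat (elemOf (asOf z) v.length) * decodeNat (elemOf (svOf z) v.length)) := by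
  simp [pieceFn, elemFn_boolPair, bitsToNat_canonF]

/-- `|asOf z| ≤ |z|` on every input. [folklore] -/
theorem length_asOf_le (z : List Bool) : (asOf z).length ≤ z.length := by
  simp only [asOf, itemOf, xOf, Function.comp_apply, fanoutFn_apply, elemFn_boolPair]
  refine (length_fstF_le_and _).2.trans ((length_fstF_le_and _).1.trans ((length_elemOf_le _ _).trans
    ((length_sndPow_two_le _).trans ((length_fstF_le_and _).1.trans ((length_fstF_le_and _).1.trans
      (length_fstF_le_and _).1)))))

/-- `|svOf z| ≤ |z|` on every input. [folklore] -/
theorem length_svOf_le (z : List Bool) : (svOf z).length ≤ z.length := by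
  simp only [svOf, aOf, Function.comp_apply]
  exact (length_fstF_le_and _).2.trans ((length_fstF_le_and _).1.trans ((length_fstF_le_and _).2.trans
    (length_fstF_le_and _).1))

/-- The pieces are short: `|pieceFn ⟨z, v⟩| ≤ 2 (|z| + 1)` (so that the clipped fold is the fold).
[folklore] -/
theorem length_pieceFn_le (z v : List Bool) : (pieceFn (boolPair z v)).length ≤ 2 * (z.length + 1) := by
  rw [pieceFn_rec, ← bitsToNat_canonF]
  refine (length_encodeNat_mul_le _ _).trans ?_
  have h1 := (length_elemOf_le (asOf z) v.length).trans (length_asOf_le z)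
  have h2 := (length_canonF_le (elemOf (svOf z) v.length)).trans
    (Nat.add_le_add_right ((length_elemOf_le (svOf z) v.length).trans (length_svOf_le z)) 1)
  omega

/-- **Value of the inner product** on `z` with canonical header numeral `bin N`, `N ≤ |z|`:
`Σ_{i < N} ⟦(asOf z)ᵢ⟧ · decodeNat ((svOf z)ᵢ)`. [folklore] -/
theorem dotFn_eq (z : List Bool) {N : ℕ} (hN : nthF 0 (xOf z) = encodeNat N) (h : N ≤ z.length) :
    dotFn z = encodeNat (∑ i ∈ Finset.range N,
      bitsToNat (elemOf (asOf z) i) * decodeNat (elemOf (svOf z) i)) := by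
  have hloop := foldLoop_apply addFn (clipF 2 pieceFn) (p := X) (x := z) (k := N) (by simpa using h) 0 []
  simp only [List.replicate_zero] at hloop
  have h0 := foldAcc_addFn pieceFn z N 0 0
  rw [show encodeNat 0 = ([] : List Bool) from rfl, zero_add] at h0
  have hclip : ∀ j, 0 ≤ j → j < 0 + N → (pieceFn (boolPair z (ones j))).length ≤ 2 * (z.length + 1) :=
    fun j _ _ => length_pieceFn_le z (ones j)
  have step1 : dotFn z = sndPow 2 (foldLoop addFn (clipF 2 pieceFn) X
      (boolPair z (boolPair (encodeNat N) (boolPair [] [])))) := by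
    simp only [dotFn, Function.comp_apply, fanoutFn_apply, id, hN]
  rw [step1, hloop]
  have step2 : sndPow 2 (boolPair z (boolPair [] (boolPair (ones (0 + N)) (foldAcc addFn (clipF 2 pieceFn) z 0 N [])))) =
      foldAcc addFn (clipF 2 pieceFn) z 0 N [] := by
    simp only [sndPow_succ_boolPair, sndPow_zero, sndF_boolPair]
  rw [step2, foldAcc_clipF hclip, h0]
  refine congrArg encodeNat (Finset.sum_congr rfl fun i _ => ?_)
  rw [zero_add, pieceFn_rec, bitsToNat_encodeNat, List.length_replicate]

/-- **Value of the item test** on `z = ⟨⟨⟨x, r⟩, a⟩, u⟩` with canonical header numeral `bin N`,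
`N ≤ |z|`: `[ |u| < T ∧ residual ]`, the residual test comparing, modulo `q' = ⟦nthF 1 x⟧`, the
numeral `b` of item `|u|` with the inner product (header of `a` of length `N`) or with `0`
(otherwise). [folklore] -/
theorem resFn_rec {N : ℕ} (hN : nthF 0 x = encodeNat N)
    (h : N ≤ (boolPair (boolPair (boolPair x r) a) u).length) :
    resFn C (boolPair (boolPair (boolPair x r) a) u) =
      [decide (u.length < (tunF C x).length) &&
        (if (fstF (fstF a)).length = N then
          decide ((∑ i ∈ Finset.range N, bitsToNat (elemOf (sndF (fstF (elemOf (sndPow 2 x) u.length))) i) *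
              decodeNat (elemOf (sndF (fstF a)) i)) % bitsToNat (nthF 1 x) =
            bitsToNat (sndF (elemOf (sndPow 2 x) u.length)) % bitsToNat (nthF 1 x))
        else decide (bitsToNat (sndF (elemOf (sndPow 2 x) u.length)) % bitsToNat (nthF 1 x) = 0))] := by
  have hdot := dotFn_eq (boolPair (boolPair (boolPair x r) a) u) (N := N) (by rw [xOf_rec, hN]) h
  rw [asOf_rec, svOf_rec] at hdot
  have hlt : (ltLenF ∘ fanoutFn sndF (tunF C ∘ xOf)) (boolPair (boolPair (boolPair x r) a) u) =
      [decide (u.length < (tunF C x).length)] := by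
    simp
  have hhdr : hdrOk (boolPair (boolPair (boolPair x r) a) u) = [decide ((fstF (fstF a)).length = N)] := by
    rw [hdrOk_rec, hN, bitsToNat_encodeNat]
  have hresDot : resDot (boolPair (boolPair (boolPair x r) a) u) = [decide ((∑ i ∈ Finset.range N,
      bitsToNat (elemOf (sndF (fstF (elemOf (sndPow 2 x) u.length))) i) * decodeNat (elemOf (sndF (fstF a)) i)) %
        bitsToNat (nthF 1 x) = bitsToNat (sndF (elemOf (sndPow 2 x) u.length)) % bitsToNat (nthF 1 x))] := by
    simp only [resDot, Function.comp_apply, fanoutFn_apply, hdot, remFn_boolPair, bitsToNat_encodeNat,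
      eqValFn_boolPair, bOf_rec, xOf_rec]
  have hresZero : resZero (boolPair (boolPair (boolPair x r) a) u) =
      [decide (bitsToNat (sndF (elemOf (sndPow 2 x) u.length)) % bitsToNat (nthF 1 x) = 0)] := by
    simp only [resZero, Function.comp_apply, fanoutFn_apply, remFn_boolPair, bitsToNat_encodeNat,
      eqValFn_boolPair, bOf_rec, xOf_rec]
    rfl
  rw [show resFn C (boolPair (boolPair (boolPair x r) a) u) =
    andFn (ltLenF ∘ fanoutFn sndF (tunF C ∘ xOf)) (iteFn hdrOk resDot resZero)
      (boolPair (boolPair (boolPair x r) a) u) from rfl]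
  by_cases hh : (fstF (fstF a)).length = N
  · rw [andFn_apply hlt (show iteFn hdrOk resDot resZero (boolPair (boolPair (boolPair x r) a) u) = _ from by
      rw [iteFn_apply_true (by rw [hhdr]; simp [hh]), hresDot]), if_pos hh]
  · rw [andFn_apply hlt (show iteFn hdrOk resDot resZero (boolPair (boolPair (boolPair x r) a) u) = _ from by
      rw [iteFn_apply_false (by rw [hhdr]; simp [hh]), hresZero]), if_neg hh]

/-- The item test rejects indices beyond the test block (whatever the rest). [folklore] -/
theorem resFn_rec_of_le (h : (tunF C x).length ≤ u.length) :
    resFn C (boolPair (boolPair (boolPair x r) a) u) = [false] := by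
  have hlt : (ltLenF ∘ fanoutFn sndF (tunF C ∘ xOf)) (boolPair (boolPair (boolPair x r) a) u) = [false] := by
    simp [Nat.not_lt.2 h]
  obtain ⟨b, hb⟩ := (OneBit.ite oneBit_hdrOk oneBit_resDot oneBit_resZero) (boolPair (boolPair (boolPair x r) a) u)
  rw [show resFn C (boolPair (boolPair (boolPair x r) a) u) =
    andFn (ltLenF ∘ fanoutFn sndF (tunF C ∘ xOf)) (iteFn hdrOk resDot resZero)
      (boolPair (boolPair (boolPair x r) a) u) from rfl, andFn_apply hlt hb, Bool.false_and]

/-- **Value of the threshold test** on `⟨⟨⟨x, r⟩, a⟩, bits⟩`: `[(2k+1) T ≤ 2k · q' · #ones(bits)]`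
with `T = |tunF C x|`, `q' = min ⟦nthF 1 x⟧ |x|`. [folklore] -/
theorem evalFn_rec (bits : List Bool) : evalFn C k (boolPair (boolPair (boolPair x r) a) bits) =
    [decide ((2 * k + 1) * (tunF C x).length ≤
      2 * k * (min (bitsToNat (nthF 1 x)) x.length * bits.count true))] := by
  have hmin : min (bits.count true) bits.length = bits.count true := min_eq_left List.count_le_length
  have h := notFn_apply (c := ltLenF ∘ fanoutFn
    (HashBricks.umulFn ∘ fanoutFn (fun _ => ones (2 * k))
      (HashBricks.umulFn ∘ fanoutFn (binToUnaryFn ∘ fanoutFn id (nthF 1) ∘ fstF ∘ fstF ∘ fstF)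
        (binToUnaryFn ∘ fanoutFn sndF (HashBricks.popCountFn ∘ sndF))))
    (HashBricks.umulFn ∘ fanoutFn (fun _ => ones (2 * k + 1)) (tunF C ∘ fstF ∘ fstF ∘ fstF)))
    (z := boolPair (boolPair (boolPair x r) a) bits)
    (b := decide (2 * k * (min (bitsToNat (nthF 1 x)) x.length * bits.count true) < (2 * k + 1) * (tunF C x).length))
    (by simp [HashBricks.umulFn_apply, HashBricks.popCountFn_apply, bitsToNat_encodeNat, hmin])
  rw [evalFn, h]
  simp only [List.cons.injEq, and_true]
  by_cases hc : (2 * k + 1) * (tunF C x).length ≤ 2 * k * (min (bitsToNat (nthF 1 x)) x.length * bits.count true)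
  · rw [decide_eq_true hc, decide_eq_false (Nat.not_lt.2 hc)]; rfl
  · rw [decide_eq_false hc, decide_eq_true (Nat.lt_of_not_le hc)]; rfl

end Values

end S2D

end Literature.Computability.Complexity

end
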